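import Summits.PneNP.PneNP.Theorems.ChebyshevTracialDesignJuntaMatchingVirtualPositivity
import HarnessLib

/-!
# Cell pnp-psdrank, route `ChebyshevTracialDesign`: GENERIC DESIGN-VALUE ASSEMBLY — per-cut level polynomials of degree `≤ D`
# price ANY kernel at minus its averaged virtual value (crux `TracialDecayExp20`, stmt-PneNP-19878; eng g13, MEMO-13 §4)

The frame of `…JuntaMatchingVirtualPositivity.sum_levelWeight_trace_nonpos_of_junta_matching` (prover, part F), stated ONCE for an arbitrary
kernel `K : OddSet n → PMatch n → ℝ` so that every matching-side pricing theorem (juntas, low-degree factors, star dictionaries) only has to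
produce its per-cut polynomial: if for every `t`-cut `U` the level sums `Σ_{M : cc(U,M) = c} K(U,M)` equal `#{M : cc(U,M) = c}·P_U(c)` along the
odd levels, for a real polynomial `P_U` of degree `≤ D`, then an exact design `(C, w)` of degree `D` on the `t`-cuts
[cite: Rothvoss2017, §2 (PDF p. 6): the level classes `Q_c` and the double count] gives
  `Σ_U Σ_M levelWeight(U,M)·K(U,M) = −(#{U : |U| = t})⁻¹ · Σ_{|U| = t} P_U(0)`      (`design_value_eq_neg_avg_virtual`),
hence `≤ 0` when every `P_U(0) ≥ 0` (`design_value_nonpos_of_levelPoly`). Ingredients: `#{M : cc(U,M) = c}·(c!·2^i i!·2^{i'} i'!) = t!(n−t)!`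
(part D `card_pm_filter_cr_mul`), `|Q_c| = #t-cuts · #{M : cc = c}`, exactness `Σ_c w_c P(c) = −P(0)`.
Stature: support/instrument (no defs, axioms standard). WHAT THIS IS NOT: no positivity statement of its own, nothing on the dense cell,
nothing on psd rank, no P-vs-NP content. Supports stmt-PneNP-19878.
-/

set_option linter.dupNamespace false -- `Summit.PneNP.PneNP.…`: summit = sub-problem (D-0017)

noncomputable section

namespace Summit.PneNP.PneNP.Theorems.ChebyshevTracialDesignDesignLevelPolyAssembly

open Finset Matrix Polynomial Literature.Barriers.PneNP Literature.Combinatorics.Optimization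
open Summit.PneNP.PneNP.Theorems.ChebyshevTracialDesignJunta

variable {n : ℕ}

/-! ### §1 Generic assembly: per-cut level polynomials ⇒ design value = minus the averaged virtual value -/

/-- Per-cut level sums of an arbitrary kernel through `perfectMatchings univ` (the frame of `…Junta.sum_pmatch_level_eq`). [folklore] -/
theorem sum_pmatch_level_eq' (U : OddSet n) {t c : ℕ} (hUt : U.1.card = t) (g : PMatch n → ℝ) :
    ∑ M : PMatch n, (if U.1.card = t ∧ cc U M = c then g M else 0) =
      ∑ M' ∈ (perfectMatchings (univ : Finset (Fin n))).filter
          (fun M' => (M'.filter fun e => cutCount U.1 e = 1).card = c),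
        (if h : IsPMOn (univ : Finset (Fin n)) M' then g ⟨M', h⟩ else 0) := by
  classical
  set φ : Finset (Sym2 (Fin n)) → ℝ := fun M' =>
    if (M'.filter fun e => cutCount U.1 e = 1).card = c then
      (if h : IsPMOn (univ : Finset (Fin n)) M' then g ⟨M', h⟩ else 0) else 0 with hφ
  have h1 : ∑ M : PMatch n, (if U.1.card = t ∧ cc U M = c then g M else 0) = ∑ M : PMatch n, φ M.1 := by
    refine Fintype.sum_congr _ _ fun M => ?_
    rw [hφ]
    simp only [hUt, true_and, cc_eq_card_filter, dif_pos M.2]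
  have h2 : ∑ M : PMatch n, φ M.1 = ∑ M' ∈ perfectMatchings (univ : Finset (Fin n)), φ M' :=
    (sum_subtype _ (fun M' => mem_perfectMatchings) φ).symm
  rw [h1, h2, hφ, ← sum_filter]

/-- **GENERIC ASSEMBLY.** For an exact design `(C, w)` of degree `D` on the `t`-cuts and a kernel `K` whose per-cut level sums are
`#{M : cc(U,M) = c}·P_U(c)` for polynomials `P_U` of degree `≤ D` (`P_U = 0` off the `t`-cuts), the design value is
`Σ_U Σ_M levelWeight(U,M)·K(U,M) = −(#{U : |U| = t})⁻¹ · Σ_U P_U(0)` — exactness prices every cut's profile at its virtual value.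
[cite: Rothvoss2017, §2 (PDF p. 6)] -/
theorem design_value_eq_neg_avg_virtual {t T D : ℕ} {Bv : ℝ} {C : Finset ℕ} {w : ℕ → ℝ}
    (hdes : IsExactDesign n t T D Bv C w) (K : OddSet n → PMatch n → ℝ) (P : OddSet n → Polynomial ℝ)
    (hPdeg : ∀ U, (P U).natDegree ≤ D) (hPzero : ∀ U : OddSet n, U.1.card ≠ t → P U = 0)
    (hPval : ∀ U : OddSet n, U.1.card = t → ∀ c i i' : ℕ, c + 2 * i = t → c + 2 * i' = n - t →
      ∑ M : PMatch n, (if U.1.card = t ∧ cc U M = c then K U M else 0) =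
        ((((perfectMatchings (univ : Finset (Fin n))).filter fun M' =>
            (M'.filter fun e => cutCount U.1 e = 1).card = c).card : ℕ) : ℝ) * (P U).eval (c : ℝ)) :
    ∑ U, ∑ M, levelWeight n t C w U M * K U M =
      -((∑ U : OddSet n, (if U.1.card = t then (1 : ℝ) else 0))⁻¹ * ∑ U : OddSet n, (P U).eval 0) := by
  obtain ⟨htodd, htn, hTt, hC, -, hexact, -⟩ := hdes
  -- Step 1: the value as level sums (cut outside)
  have hval : ∑ U, ∑ M, levelWeight n t C w U M * K U M =
      ∑ c ∈ C, w c / ((Qset n t c).card : ℝ) *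
        ∑ U : OddSet n, ∑ M : PMatch n, (if U.1.card = t ∧ cc U M = c then K U M else 0) := by
    calc ∑ U, ∑ M, levelWeight n t C w U M * K U M
        = ∑ U, ∑ M, ∑ c ∈ C, (if (U, M) ∈ Qset n t c then w c / ((Qset n t c).card : ℝ) * K U M else 0) := by
          refine sum_congr rfl fun U _ => sum_congr rfl fun M _ => ?_
          rw [levelWeight, sum_mul]
          exact sum_congr rfl fun c _ => by split_ifs <;> simp
      _ = ∑ U, ∑ c ∈ C, ∑ M, (if (U, M) ∈ Qset n t c then w c / ((Qset n t c).card : ℝ) * K U M else 0) :=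
          sum_congr rfl fun U _ => sum_comm
      _ = ∑ c ∈ C, ∑ U, ∑ M, (if (U, M) ∈ Qset n t c then w c / ((Qset n t c).card : ℝ) * K U M else 0) := sum_comm
      _ = ∑ c ∈ C, w c / ((Qset n t c).card : ℝ) *
            ∑ U : OddSet n, ∑ M : PMatch n, (if U.1.card = t ∧ cc U M = c then K U M else 0) := by
          refine sum_congr rfl fun c _ => ?_
          rw [mul_sum]
          refine sum_congr rfl fun U _ => ?_
          rw [mul_sum]
          refine sum_congr rfl fun M _ => ?_
          simp only [mem_Qset_iff]
          split_ifs <;> simp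
  have hcardc : ∀ U : OddSet n, ((univ : Finset (Fin n)) \ U.1).card = n - U.1.card := fun U => by
    rw [card_sdiff_of_subset (subset_univ _), card_univ, Fintype.card_fin]
  -- Step 2: the number of matchings at level `c` over a `t`-cut, and `|Q_c|`
  have htot : ∀ (U : OddSet n), U.1.card = t → ∀ c i i' : ℕ, c + 2 * i = t → c + 2 * i' = n - t →
      ((((perfectMatchings (univ : Finset (Fin n))).filter fun M' =>
          (M'.filter fun e => cutCount U.1 e = 1).card = c).card : ℕ) : ℝ) *
        ((c.factorial * (2 ^ i * i.factorial) * (2 ^ i' * i'.factorial) : ℕ) : ℝ) =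
        ((t.factorial * (n - t).factorial : ℕ) : ℝ) := by
    intro U hUt c i i' hci hci'
    have key := card_pm_filter_cr_mul (subset_univ U.1) (a := c) (i := i) (i' := i')
      (by rw [hUt, hci]) (by rw [hcardc U, hUt, hci'])
    rw [hci, hci'] at key
    exact_mod_cast key
  have hQ : ∀ c i i' : ℕ, c + 2 * i = t → c + 2 * i' = n - t →
      ((Qset n t c).card : ℝ) * ((c.factorial * (2 ^ i * i.factorial) * (2 ^ i' * i'.factorial) : ℕ) : ℝ) =
        (∑ U : OddSet n, (if U.1.card = t then (1 : ℝ) else 0)) * ((t.factorial * (n - t).factorial : ℕ) : ℝ) := by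
    intro c i i' hci hci'
    have e1 : ((Qset n t c).card : ℝ) =
        ∑ U : OddSet n, ∑ M : PMatch n, (if U.1.card = t ∧ cc U M = c then (1 : ℝ) else 0) := by
      rw [Qset, Finset.card_filter, Nat.cast_sum, Fintype.sum_prod_type]
      refine sum_congr rfl fun U _ => sum_congr rfl fun M _ => ?_
      split_ifs <;> simp
    have e2 : ∀ U : OddSet n, (∑ M : PMatch n, (if U.1.card = t ∧ cc U M = c then (1 : ℝ) else 0)) *
        ((c.factorial * (2 ^ i * i.factorial) * (2 ^ i' * i'.factorial) : ℕ) : ℝ) =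
        (if U.1.card = t then (1 : ℝ) else 0) * ((t.factorial * (n - t).factorial : ℕ) : ℝ) := by
      intro U
      by_cases hUt : U.1.card = t
      · rw [if_pos hUt, one_mul, ← htot U hUt c i i' hci hci']
        congr 1
        rw [sum_pmatch_level_eq' U hUt (fun _ => (1 : ℝ)) (c := c)]
        have hall : ∀ M' ∈ (perfectMatchings (univ : Finset (Fin n))).filter
            (fun M' => (M'.filter fun e => cutCount U.1 e = 1).card = c),
            (if h : IsPMOn (univ : Finset (Fin n)) M' then (1 : ℝ) else 0) = 1 := by
          intro M' hM'
          rw [dif_pos (mem_perfectMatchings.1 (mem_filter.1 hM').1)]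
        rw [sum_congr rfl hall, sum_const, nsmul_eq_mul, mul_one]
      · rw [if_neg hUt, zero_mul]
        have : ∀ M : PMatch n, (if U.1.card = t ∧ cc U M = c then (1 : ℝ) else 0) = 0 :=
          fun M => if_neg fun h => hUt h.1
        rw [Fintype.sum_congr _ _ this]
        simp
    rw [e1, sum_mul, sum_mul]
    exact Fintype.sum_congr _ _ e2
  -- Step 3: assemble
  rw [hval]
  have hterm : ∀ c ∈ C, w c / ((Qset n t c).card : ℝ) *
      ∑ U : OddSet n, ∑ M : PMatch n, (if U.1.card = t ∧ cc U M = c then K U M else 0) =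
      (∑ U : OddSet n, (if U.1.card = t then (1 : ℝ) else 0))⁻¹ * ∑ U : OddSet n, w c * (P U).eval (c : ℝ) := by
    intro c hc
    obtain ⟨hcodd, -, hcT, hne⟩ := hC c hc
    obtain ⟨p, hp⟩ := hne
    have hn : 2 * p.2.1.card = n := by rw [two_mul_card_eq p.2.2, card_univ, Fintype.card_fin]
    have hct : c ≤ t := hcT.trans hTt
    obtain ⟨i, hi⟩ : ∃ i, c + 2 * i = t := by
      obtain ⟨a, ha⟩ := hcodd; obtain ⟨b, hb⟩ := htodd; exact ⟨b - a, by omega⟩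
    obtain ⟨i', hi'⟩ : ∃ i', c + 2 * i' = n - t := by
      obtain ⟨a, ha⟩ := hcodd; obtain ⟨b, hb⟩ := htodd; exact ⟨p.2.1.card - a - b - 1, by omega⟩
    have hQc := hQ c i i' hi hi'
    have hQ0 : ((Qset n t c).card : ℝ) ≠ 0 := by exact_mod_cast (card_pos.2 ⟨p, hp⟩).ne'
    have hK : (0 : ℝ) < ((c.factorial * (2 ^ i * i.factorial) * (2 ^ i' * i'.factorial) : ℕ) : ℝ) := by positivity
    have hN0 : (∑ U : OddSet n, (if U.1.card = t then (1 : ℝ) else 0)) ≠ 0 := by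
      intro h0; rw [h0, zero_mul] at hQc; exact (mul_ne_zero hQ0 hK.ne') hQc
    have hU : ∀ U : OddSet n, (∑ M : PMatch n, (if U.1.card = t ∧ cc U M = c then K U M else 0)) *
        ((c.factorial * (2 ^ i * i.factorial) * (2 ^ i' * i'.factorial) : ℕ) : ℝ) =
        ((t.factorial * (n - t).factorial : ℕ) : ℝ) * (P U).eval (c : ℝ) := by
      intro U
      by_cases hUt : U.1.card = t
      · rw [hPval U hUt c i i' hi hi', mul_right_comm, htot U hUt c i i' hi hi']
      · rw [hPzero U hUt]
        have : ∀ M : PMatch n, (if U.1.card = t ∧ cc U M = c then K U M else 0) = 0 :=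
          fun M => if_neg fun h => hUt h.1
        rw [Fintype.sum_congr _ _ this]
        simp
    have hQc' : ((Qset n t c).card : ℝ) =
        (∑ U : OddSet n, (if U.1.card = t then (1 : ℝ) else 0)) * ((t.factorial * (n - t).factorial : ℕ) : ℝ) /
          ((c.factorial * (2 ^ i * i.factorial) * (2 ^ i' * i'.factorial) : ℕ) : ℝ) := by
      rw [eq_div_iff hK.ne', hQc]
    have hS : (∑ U : OddSet n, ∑ M : PMatch n, (if U.1.card = t ∧ cc U M = c then K U M else 0)) =
        ((t.factorial * (n - t).factorial : ℕ) : ℝ) /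
          ((c.factorial * (2 ^ i * i.factorial) * (2 ^ i' * i'.factorial) : ℕ) : ℝ) *
          ∑ U : OddSet n, (P U).eval (c : ℝ) := by
      rw [mul_sum]
      refine Fintype.sum_congr _ _ fun U => ?_
      rw [div_mul_eq_mul_div, eq_div_iff hK.ne', hU U]
    have hF0 : ((t.factorial * (n - t).factorial : ℕ) : ℝ) ≠ 0 := by positivity
    rw [hS, hQc', mul_sum, mul_sum, mul_sum]
    refine Fintype.sum_congr _ _ fun U => ?_
    field_simp
  rw [sum_congr rfl hterm, ← mul_sum, sum_comm]
  have hinner : ∀ U : OddSet n, ∑ c ∈ C, w c * (P U).eval (c : ℝ) = -(P U).eval 0 :=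
    fun U => hexact (P U) (hPdeg U)
  rw [Fintype.sum_congr _ _ hinner, sum_neg_distrib, mul_neg]


/-- **Corollary.** If moreover every virtual value `P_U(0)` is `≥ 0`, the design value is `≤ 0`. [cite: Rothvoss2017, §2 (PDF p. 6)] -/
theorem design_value_nonpos_of_levelPoly {t T D : ℕ} {Bv : ℝ} {C : Finset ℕ} {w : ℕ → ℝ}
    (hdes : IsExactDesign n t T D Bv C w) (K : OddSet n → PMatch n → ℝ) (P : OddSet n → Polynomial ℝ)
    (hPdeg : ∀ U, (P U).natDegree ≤ D) (hP0 : ∀ U, 0 ≤ (P U).eval 0) (hPzero : ∀ U : OddSet n, U.1.card ≠ t → P U = 0)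
    (hPval : ∀ U : OddSet n, U.1.card = t → ∀ c i i' : ℕ, c + 2 * i = t → c + 2 * i' = n - t →
      ∑ M : PMatch n, (if U.1.card = t ∧ cc U M = c then K U M else 0) =
        ((((perfectMatchings (univ : Finset (Fin n))).filter fun M' =>
            (M'.filter fun e => cutCount U.1 e = 1).card = c).card : ℕ) : ℝ) * (P U).eval (c : ℝ)) :
    ∑ U, ∑ M, levelWeight n t C w U M * K U M ≤ 0 := by
  rw [design_value_eq_neg_avg_virtual hdes K P hPdeg hPzero hPval, neg_nonpos]
  exact mul_nonneg (inv_nonneg.2 (sum_nonneg fun U _ => by split_ifs <;> norm_num)) (sum_nonneg fun U _ => hP0 U)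

end Summit.PneNP.PneNP.Theorems.ChebyshevTracialDesignDesignLevelPolyAssembly
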